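import Literature.ModelTheory.FiniteModelTheory.ESOPrefixClasses
import Literature.ModelTheory.FiniteModelTheory.ESOProofs
import Literature.Computability.Complexity.NPClosureProofs
import HarnessLib

/-!
# Generalized spectra and complement: `NP = coNP ⇒ ∃SO` is closed under complement, and Fagin's
test class `𝒩` (non-3-colourability)

Fagin 1993, §5: by Fagin's theorem (`fagin_theorem_holds`), the class of generalized spectra
(`∃SO`-definable, isomorphism-closed classes of finite structures) is closed under complement iff
`NP` is (Thm. 5.2), and — 3-colourability being a generalized spectrum (the sentence
`∃A ∃B ∃C (∀x (Ax ∨ Bx ∨ Cx) ∧ ∀x ∀y (Exy → ¬(Ax ∧ Ay) ∧ ¬(Bx ∧ By) ∧ ¬(Cx ∧ Cy)))`, Fagin 1993,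
§4) — the class `𝒩` of NON-3-colourable finite graphs is a generalized spectrum iff every
complement of a generalized spectrum is one (Thm. 5.3, via NP-completeness of 3-colourability).

PROVED here (sorry-free), in the tree's setting (`IsESODefinable`, table codes
`encodingSNPInstance`, `Nondeterministic.NP = polyExists P`):

* `codes_mem_P` — the set of ALL codes of finite `ar`-structures is in `P` (the verifier of the
  trivially true sentence, `ESOSentence.verifierLanguage_mem_P_holds`);
* `isESODefinable_compl_of_NP_eq_coNP` — Thm. 5.2, direction `⇐`: if `NP = coNP` then the
  complement of an `∃SO`-definable class over a non-degenerate vocabulary is `∃SO`-definable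
  (easy Fagin direction puts the codes in `NP = coNP`, intersect the complement with the `P`-set
  of codes, hard Fagin direction);
* `isESODefinable_threeColClass` — 3-colourability is a generalized spectrum (Fagin's sentence,
  through the `JQuery.IsDef` toolkit of `ESODefinability.lean`);
* `NP_ne_coNP_of_not_isESODefinable_nonThreeColClass` — Thm. 5.3, the direction used by lower-bound
  routes: if `𝒩` is NOT a generalized spectrum then `NP ≠ coNP`.

The converse of the last statement (𝒩 ∈ ∃SO ⇒ NP = coNP) needs the NP-completeness of
3-colourability under reductions first-order enough to stay inside `∃SO`; it is recorded as the
NAMED FACT `nonThreeCol_genSpectrum_iff_NP_eq_coNP` and not proved here.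

## References

* R. Fagin, *Finite-model theory — a personal perspective*, TCS 116 (1993) 3–31, §4 (the
  3-colourability sentence), §5, Thms. 5.1–5.3.
* R. Fagin, *Generalized first-order spectra and polynomial-time recognizable sets*, 1974, Thm. 10
  (closure under complement iff `NP = coNP`).
-/

namespace Literature.ModelTheory.FiniteModelTheory

open Literature.Computability.Cryptography Literature.Computability.Complexity
  Literature.Computability.Complexity.Nondeterministic FirstOrder FirstOrder.Language

/-! ### All codes form a `P`-set -/

section Codes

variable (ar : List ℕ)

/-- The trivially true `∃SO` sentence with no witnesses. [folklore] -/
def ESOSentence.trueSentence : ESOSentence ar := ⟨[], ⊤⟩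

/-- **The language of all codes of finite `ar`-structures is in `P`** (non-degenerate `ar`): it is
the preimage of the `P` verifier language of the true sentence under `z ↦ ⟨z, []⟩`.
[Libkin 2004, Prop. 6.6 (data complexity); folklore] [folklore] -/
theorem codes_mem_P (har : IsNondegenerateVocab ar) :
    (encodingSNPInstance ar).toLanguage Set.univ ∈ Classes.P := by
  have hV := ESOSentence.verifierLanguage_mem_P_holds ar har (ESOSentence.trueSentence ar)
  have hf : (fanoutFn id fun _ => ([] : List Bool)) ∈ FP :=
    fanoutFn_mem_FP OracleCompose.id_mem_FP (const_mem_FP _)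
  have hEq : (encodingSNPInstance ar).toLanguage Set.univ =
      (fanoutFn id fun _ => ([] : List Bool)) ⁻¹' (ESOSentence.trueSentence ar).verifierLanguage := by
    refine Set.ext fun z => ?_
    simp only [Set.mem_preimage, fanoutFn_apply, id]
    constructor
    · rintro ⟨⟨n, R⟩, -, rfl⟩
      refine ⟨n, R, (fun _ _ => false), ?_, ?_⟩
      · congr 1
      · letI := jointStructure (wit := (ESOSentence.trueSentence ar).witnessArities) R fun _ _ => false
        exact (FirstOrder.Language.BoundedFormula.realize_top (v := default) (xs := default)).2 trivial
    · rintro ⟨n, R, W, he, -⟩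
      obtain ⟨hx, -⟩ := Prod.mk.inj (boolPair_injective he)
      exact ⟨⟨n, R⟩, Set.mem_univ _, hx⟩
  rw [hEq]
  exact preimage_mem_P hV hf

/-- Codes of the complement class: all codes, minus the codes of the class. [folklore] -/
theorem toLanguage_compl (C : Set (SNPInstance ar)) :
    (encodingSNPInstance ar).toLanguage Cᶜ =
      (encodingSNPInstance ar).toLanguage Set.univ ⊓ ((encodingSNPInstance ar).toLanguage C)ᶜ := by
  ext z
  constructor
  · rintro ⟨x, hx, rfl⟩
    refine ⟨⟨x, Set.mem_univ _, rfl⟩, ?_⟩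
    intro h
    exact hx ((_root_.Computability.Encoding.mem_toLanguage_iff _ _ _).1 h)
  · rintro ⟨⟨x, -, rfl⟩, h⟩
    exact ⟨x, fun hx => h ((_root_.Computability.Encoding.mem_toLanguage_iff _ _ _).2 hx), rfl⟩

end Codes

/-! ### Fagin 1993, Thm. 5.2 (`⇐`): `NP = coNP` closes generalized spectra under complement -/

/-- The complement of an isomorphism-closed class is isomorphism-closed. [folklore] -/
theorem IsIsoClosedStr.compl {ar : List ℕ} {C : Set (SNPInstance ar)} (h : IsIsoClosedStr ar C) :
    IsIsoClosedStr ar Cᶜ :=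
  fun n R π => not_congr (h n R π)

/-- **Fagin 1993, Thm. 5.2, direction `⇐`** (Fagin 1974, Thm. 10): if `NP` is closed under
complement then so is the class of generalized spectra — over a non-degenerate vocabulary the
complement of an `∃SO`-definable class is `∃SO`-definable.  Proof: codes of `C` are in `NP = coNP`
(`eso_subset_NP_holds`), so the codes of `Cᶜ` = (all codes, a `P`-set) ∩ (codes of `C`)ᶜ are in
`NP`, and `Cᶜ` is isomorphism-closed, so `NP_subset_eso_holds` applies.
[Fagin 1993, Thm. 5.2] [cite: Fagin1993, Thm. 5.2] -/
theorem isESODefinable_compl_of_NP_eq_coNP {ar : List ℕ} (har : IsNondegenerateVocab ar)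
    (hNP : NP = coNP) {C : Set (SNPInstance ar)} (hC : IsESODefinable ar C) :
    IsESODefinable ar Cᶜ := by
  obtain ⟨Φ, rfl⟩ := hC
  have hL : Φ.language ∈ NP := eso_subset_NP_holds ar har Φ
  have hLc : (Φ.language)ᶜ ∈ NP := by
    rw [hNP] at hL
    exact hL
  have hcodes := codes_mem_P ar har
  have hcompl : (encodingSNPInstance ar).toLanguage Φ.modelClassᶜ ∈ NP := by
    rw [toLanguage_compl]
    exact inter_P_mem_polyExists (K := Classes.P) (fun _ _ h₁ h₂ => inter_mem_P h₁ h₂) hcodes hLc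
  exact NP_subset_eso_holds ar _ har Φ.isIsoClosedStr_modelClass.compl hcompl

/-! ### 3-colourability is a generalized spectrum (Fagin's sentence) -/

section ThreeCol

open JQuery

/-- Fagin's sentence for 3-colourability as a closed query over three unary witnesses
`W₀, W₁, W₂` ("colour classes"): every vertex has a colour, and no edge of the graph of the input
table is monochromatic. [Fagin 1993, §4 ("the graph is 3-colorable")] [cite: Fagin1993, §4] -/
def threeColQuery : JQuery [2] [1, 1, 1] Empty := fun n R W _ =>
  (∀ u : Fin n, ∃ c : Fin [1, 1, 1].length, W c (fun _ => u) = true) ∧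
    ∀ u v : Fin n, (graphOfTables R).Adj u v →
      ∀ c : Fin [1, 1, 1].length, ¬ (W c (fun _ => u) = true ∧ W c (fun _ => v) = true)

/-- Adjacency in the graph of the input table is a definable query (two variables).
[folklore] -/
theorem isDef_adj :
    IsDef (fun n (R : RelTables [2] n) (_ : RelTables [1, 1, 1] n)
      (v : (Empty ⊕ Unit) ⊕ Unit → Fin n) =>
        (graphOfTables R).Adj (v (Sum.inl (Sum.inr ()))) (v (Sum.inr ()))) := by
  refine (((isDef_eq (ar := [2]) (wit := [1, 1, 1]) (Sum.inl (Sum.inr ())) (Sum.inr ())).not).and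
    ((isDef_inRel (ar := [2]) (wit := [1, 1, 1]) (α := (Empty ⊕ Unit) ⊕ Unit) ⟨0, by decide⟩
        ![Sum.inl (Sum.inr ()), Sum.inr ()]).or
      (isDef_inRel (ar := [2]) (wit := [1, 1, 1]) (α := (Empty ⊕ Unit) ⊕ Unit) ⟨0, by decide⟩
        ![Sum.inr (), Sum.inl (Sum.inr ())]))).of_iff
    fun n R W v => ?_
  have e1 : (v ∘ ![Sum.inl (Sum.inr ()), Sum.inr ()] : Fin ([2].get ⟨0, by decide⟩) → Fin n) =
      ![v (Sum.inl (Sum.inr ())), v (Sum.inr ())] := by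
    funext i
    rcases i with ⟨_ | _ | k, hk⟩
    · rfl
    · rfl
    · exfalso
      simp only [List.get_eq_getElem, List.getElem_cons_zero] at hk
      omega
  have e2 : (v ∘ ![Sum.inr (), Sum.inl (Sum.inr ())] : Fin ([2].get ⟨0, by decide⟩) → Fin n) =
      ![v (Sum.inr ()), v (Sum.inl (Sum.inr ()))] := by
    funext i
    rcases i with ⟨_ | _ | k, hk⟩
    · rfl
    · rfl
    · exfalso
      simp only [List.get_eq_getElem, List.getElem_cons_zero] at hk
      omega
  rw [graphOfTables_adj, e1, e2]
  rfl

/-- Fagin's 3-colourability query is first-order definable. [Fagin 1993, §4] [folklore] -/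
theorem isDef_threeColQuery : threeColQuery.IsDef := by
  have h1 : IsDef (fun n (_ : RelTables [2] n) (W : RelTables [1, 1, 1] n) (_ : Empty → Fin n) =>
      ∀ u : Fin n, ∃ c : Fin [1, 1, 1].length, W c (fun _ => u) = true) :=
    (IsDef.iSup fun c : Fin [1, 1, 1].length =>
      isDef_witRel (ar := [2]) (wit := [1, 1, 1]) (α := Empty ⊕ Unit) c (fun _ => Sum.inr ())).all
  have hcol : ∀ c : Fin [1, 1, 1].length,
      IsDef (fun n (_ : RelTables [2] n) (W : RelTables [1, 1, 1] n)
        (v : (Empty ⊕ Unit) ⊕ Unit → Fin n) =>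
          W c (fun _ => v (Sum.inl (Sum.inr ()))) = true ∧ W c (fun _ => v (Sum.inr ())) = true) :=
    fun c => (isDef_witRel (ar := [2]) c (fun _ => Sum.inl (Sum.inr ()))).and
      (isDef_witRel (ar := [2]) c (fun _ => Sum.inr ()))
  have h2 : IsDef (fun n (R : RelTables [2] n) (W : RelTables [1, 1, 1] n) (_ : Empty → Fin n) =>
      ∀ u v : Fin n, (graphOfTables R).Adj u v →
        ∀ c : Fin [1, 1, 1].length, ¬ (W c (fun _ => u) = true ∧ W c (fun _ => v) = true)) :=
    ((isDef_adj.imp (IsDef.iInf fun c => (hcol c).not)).all.all).of_iff fun n R W v => by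
      simp only [Sum.elim_inl, Sum.elim_inr]
  exact (h1.and h2).of_iff fun n R W v => Iff.rfl

/-- Every witness symbol of `[1, 1, 1]` is unary (so its argument tuples are nonempty). [folklore] -/
theorem arity_pos_of_colWit (c : Fin [1, 1, 1].length) : 0 < [1, 1, 1].get c := by
  have h := List.get_mem [1, 1, 1] c
  simp only [List.mem_cons, List.not_mem_nil, or_false] at h
  omega

/-- Fagin's sentence holds on `⟨n, R⟩` iff the graph of `R` is 3-colourable. [Fagin 1993, §4]
[folklore] -/
theorem exists_threeColQuery_iff (n : ℕ) (R : RelTables [2] n) :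
    (∃ W : RelTables [1, 1, 1] n, threeColQuery R W Empty.elim) ↔ (graphOfTables R).Colorable 3 := by
  constructor
  · rintro ⟨W, hcov, hind⟩
    choose f hf using hcov
    have hvalid : ∀ {u v : Fin n}, (graphOfTables R).Adj u v → f u ≠ f v := by
      intro u v huv heq
      exact hind u v huv (f u) ⟨hf u, heq ▸ hf v⟩
    simpa using (SimpleGraph.Coloring.mk f hvalid).colorable
  · intro hc
    obtain ⟨C⟩ := hc
    refine ⟨fun c t => decide (∀ j, ((C (t j) : Fin 3) : ℕ) = (c : ℕ)), fun u => ?_, fun u v huv c => ?_⟩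
    · refine ⟨⟨(C u : ℕ), by simp⟩, ?_⟩
      simp
    · simp only [decide_eq_true_eq, not_and]
      intro hu hv
      have hu' := hu ⟨0, arity_pos_of_colWit c⟩
      have hv' := hv ⟨0, arity_pos_of_colWit c⟩
      exact C.valid huv (Fin.ext (hu'.trans hv'.symm))

/-- **3-colourability is a generalized spectrum.** [Fagin 1993, §4] [cite: Fagin1993, §4] -/
theorem isESODefinable_threeColClass : IsESODefinable [2] threeColClass :=
  IsESODefinable.of_isDef_iff isDef_threeColQuery fun n R =>
    (mem_threeColClass_iff ⟨n, R⟩).trans (exists_threeColQuery_iff n R).symm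

/-- Hence the classes of 3-colourable and of non-3-colourable graphs are isomorphism-closed.
[folklore] -/
theorem isIsoClosedStr_nonThreeColClass : IsIsoClosedStr [2] nonThreeColClass := by
  rw [nonThreeColClass_eq_compl]
  exact isESODefinable_threeColClass.isIsoClosedStr.compl

end ThreeCol

/-! ### Fagin 1993, Thm. 5.3: the test class `𝒩` -/

/-- The binary vocabulary `[2]` is non-degenerate. [folklore] -/
theorem isNondegenerateVocab_two : IsNondegenerateVocab [2] := ⟨2, by simp, by norm_num⟩

/-- **Fagin 1993, Thm. 5.3 with Thm. 5.2 (the direction lower-bound routes use):** if the class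
`𝒩` of non-3-colourable finite graphs is NOT a generalized spectrum, then `NP ≠ coNP`.
[Fagin 1993, Thm. 5.3] [cite: Fagin1993, Thm. 5.3] -/
theorem NP_ne_coNP_of_not_isESODefinable_nonThreeColClass
    (h : ¬ IsESODefinable [2] nonThreeColClass) : NP ≠ coNP := by
  intro hNP
  apply h
  rw [nonThreeColClass_eq_compl]
  exact isESODefinable_compl_of_NP_eq_coNP isNondegenerateVocab_two hNP isESODefinable_threeColClass

/-- NAMED FACT (**Fagin 1993, Thms. 5.2 + 5.3**): `𝒩` is a generalized spectrum iff `NP = coNP`.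
The direction `⇐` is `NP_ne_coNP_of_not_isESODefinable_nonThreeColClass` (proved above); `⇒`
needs the NP-completeness of 3-colourability by a reduction expressible inside `∃SO` (Fagin 1974,
via Thm. 5.1) and is not proved in the tree. Users take `(h : nonThreeCol_genSpectrum_iff_NP_eq_coNP)`.
[Fagin 1993, Thms. 5.2–5.3] [cite: Fagin1993, Thms. 5.2–5.3] -/
def nonThreeCol_genSpectrum_iff_NP_eq_coNP : Prop :=
  IsESODefinable [2] nonThreeColClass ↔ NP = coNP

end Literature.ModelTheory.FiniteModelTheory
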